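/-
Copyright (c) 2026 the pub-hodgecm-mathlib formalisation cell (harness21).  Prover seat hodgecm-mathlib-K2E1-p13 (g5), Track B ∕ K2-LIT, h413 = `stmt-HodgeConjecture-24833`,
R90-TF section S8 «ContSpec-n½» (dealer R90-CS-plan (g3), deal S8-R131 (7); census `R90/S8/CENSUS-IwasawaSplitU3.K2E1-p13-g5.md`): the SPLIT-place Iwasawa torus entries of the
`U(2,1)` big cell `w₀·n(x,y,z)` in `GL₃` over a non-archimedean local field — the torus-entry letters (α) of ★ `K2E1ChiLocalWeightShellU3.shell_split_of_torusEntries` ∕ ★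
`K2E1ChiLocalMeansOfShellU3Letters.hsp_of_torusEntries`, split twin of ★ `K2E1BigCellIwasawaTorusEntryU3` (R90-C10-p07, inert).
-/
import Literature.NumberTheory.Automorphic.IwasawaDecompositionGL     -- ★ `glInt`, `isIntegralMatrix_of_mem_glInt`, `exists_borel_mul_glInt` (Bump 4.5.2), `standardParabolicGL`, `apply_self_ne_zero_of_blockTriangular`
import Literature.NumberTheory.Automorphic.AddCharConductorExponent    -- ★ `normAbs` ultrametric API: `normAbs_add_le_max`, `normAbs_neg`; brings ★ `normAbs_le_one_iff`
import HarnessLib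

/-!
# K2·E1 ∕ R90·S8 — `K2E1BigCellIwasawaTorusEntrySplitU3`: THE IWASAWA TORUS ENTRIES OF `w₀ · n(x, y, z)` IN `GL₃(F)` ARE THE TWO GINDIKIN–KARPELEVICH HEIGHTS
# (`‖b₂₂‖ = max(1,|x|,|z|) = A`, `‖b₀₀‖ · max(1,|y|,|z − xy|) = ‖b₀₀‖ · B = 1` for EVERY factorisation `w₀·n = b·k`, `b` upper triangular, `k ∈ GL₃(𝒪)`) — the split-place (α)-letters

Cell `pub/hodgecm-mathlib`, crux h413 = `stmt-HodgeConjecture-24833`, route of record `HCCMUnconditional`; R90-TF section S8 «ContSpec-n½», road R2-χ₃ (the (V) scalar road: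
★ (a-1) `K2E1ChiIntertwiningScalarEulerProductU3Finite` ← ★ `K2E1ChiLocalMeansOfShellU3Letters.hsp_of_torusEntries` ← ★ (W) `K2E1ChiLocalWeightShellU3.shell_split_of_torusEntries` ←
THIS FILE).  THEOREMS ONLY (no `def`, no `instance`, no notation, no named-fact hypothesis, no `sorry`; default heartbeats); lane `--supports stmt-HodgeConjecture-24833 --as helper`
(count-neutral).  Closes no socket.  Generic non-archimedean local field `F` (= `L⁺_v ≅ L_w` at a place `v` of `L⁺` split in the CM field `L`, `U(2,1)(L⁺_v) ≅ GL₃(L_w)` by ★ `localSplitEquiv`).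

THE MATHEMATICS ([Bump1997] Prop. 4.5.2; [Casselman1980] §3; [Langlands1971] §3; [MoeglinWaldspurger1995] I.2.2, II.1.6; [Rogawski1990] §4.5 p. 45).  In `GL₃(F)` let
`w₀ = antidiag(1,1,1)` and `n = n(x,y,z) = (1 x z; 0 1 y; 0 0 1)`, and let `w₀ · n = b · k` be ANY factorisation with `b` upper triangular (invertible) and `k ∈ K = GL₃(𝒪)` (one exists:
Iwasawa, ★ `exists_borel_mul_glInt`).  Rows and columns of elements of `GL₃(𝒪)` are PRIMITIVE (§1: all entries in `𝒪`, one of absolute value `1` — ultrametric inequality on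
`Σ_j k_ij (k⁻¹)_ji = 1`).  The bottom row of `b·k` is `b₂₂ · (bottom row of k)` and the bottom row of `w₀·n` is `(1, x, z)`, so (§2) **`‖b₂₂‖ = max(1, |x|, |z|) =: A`**; the first
column of `k⁻¹ = (w₀ n)⁻¹ · b` is `b₀₀ · (first column of n⁻¹ w₀) = b₀₀ · (xy − z, −y, 1)ᵀ`, so **`‖b₀₀‖ · max(1, |y|, |z − xy|) = ‖b₀₀‖ · B = 1`**; and `‖b₀₀ b₁₁ b₂₂‖ = ‖det(w₀ n)‖ = 1`.
These are the two Gindikin–Karpelevich heights of ★ `K2E1GindikinKarpelevichSplitGL3` («`|t₃| = A`, `|t₂t₃| = B`»), i.e. in the base coordinates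
`Φ(p) = (p₀ + δ₁p₁, −(p₀ − δ₁p₁), δ₁p₂ − ½(p₀ + δ₁p₁)(p₀ − δ₁p₁))` of ★ `K2E1IntertwiningLocalMeanSplitU3` ∕ ★ `K2E1IntertwiningLocalFactorU3HeightSplit` (`δ₁ = δ_w =` ★ `splitSqrt … v w`) the
factors `A_w = max(1,‖X_w‖,‖Z_w‖)`, `B_w = max(1,‖X_w̄‖,‖Z_w̄‖)` of the `U(2,1)` big-cell height.  §3 packages the TORUS-ENTRY LETTERS (α) of ★ (W) §3 ∕ ★ `hsp_of_torusEntries` in their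
EXACT bytes: `α₁ p := (b₂₂(p))⁻¹` with `‖α₁ p‖ · A(p) = 1`, `α₂ p := b₀₀(p)` with `‖α₂ p‖ · B(p) = 1` (for ALL `p` — the `1 <` guards of the letters are not needed), TOGETHER with the
factorisation clause `w₀ · n(Φ p) = b(p) · k(p)`, `k(p) ∈ GL₃(𝒪)`, from which the consumer reads the weight letters (c) (`c_j = χ_j ∘ α_j` for unramified `χ_j`; `ω = c₁ c₂`).
* §1 `normAbs_sum_le_of_forall_le`, `exists_one_le_normAbs_of_sum_mul_eq_one`, **`exists_normAbs_row_eq_one_of_mem_glInt`**, **`exists_normAbs_col_eq_one_of_mem_glInt`** (any `n`).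
* §2 (`GL₃`, ANY factorisation `g = b·k`): `normAbs_apply_two_le_of_eq_borel_mul` ∕ `exists_normAbs_apply_two_eq_of_eq_borel_mul` (bottom row ↔ `b₂₂`),
  `normAbs_inv_apply_zero_mul_le_of_eq_borel_mul` ∕ `exists_…_eq_…` (first column of `g⁻¹` ↔ `b₀₀⁻¹`); the big cell: `weylLong_mul_heis_val`, `heis_inv_val`, `weylLong_inv_val`,
  **`normAbs_borel_two_two_eq_heightA`**, **`normAbs_borel_zero_zero_mul_heightB_eq_one`**, `normAbs_borel_diag_prod_eq_one`.
* §3 **`exists_iwasawa_torusEntries_split`** (base coordinates, any `δ₁`; factorisation + (α)-letters unguarded AND in the guarded bytes of ★ (W) §3 ∕ ★ p863122).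
HONEST SCOPE ∕ IDENTIFICATION NOTE (census §5).  NOT here: the transport `U(2,1)(L⁺_v) ≅ GL₃(L_w)` (★ `localSplitEquiv`, ★ `localPiSplitEquiv_symm_mem_localInt_iff` for `K_v ↔ GL₃(𝒪_w)`)
and the reading of the χ-section's weight `ω` (letters (c)) — the supplier's business.  For that reading: with `J = Φ₃` the `U(2,1)` first torus entry of the Borel part is
`(b₀₀, τ(b₂₂)⁻¹) ∈ L_w^× × L_w̄^×` (the `w̄`-component of `t` is `τ(Φ₃ t_w^{−T} Φ₃)`, which reverses the diagonal), so a Hecke character `φ` read on the first torus entry puts `φ_w` on the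
entry of norm `B_w⁻¹` and `φ_w̄` on the entry of norm `A_w⁻¹`: in the ∃-shape of ★ `hsp_of_torusEntries` the character `χ₁` carried by height `A_w` is `φ_w̄ ∘ ι_w̄` (use ★ `splitToken_symm`).
HONEST LABEL: HC_CM is proved only modulo the 7 printed citations (2 remaining named inputs: hLiu418 = `stmt-HodgeConjecture-24832`, h413 = `stmt-HodgeConjecture-24833`) until rung 0
closes; REL ≠ ★ ≠ BUILT; this file asserts no named fact and closes no socket; count-neutral; unconditional matrix algebra and local valuation bookkeeping.

## References
* [Bump1997] D. Bump, *Automorphic Forms and Representations*, Cambridge Stud. Adv. Math. 55 (1997): Prop. 4.5.2 (Iwasawa decomposition `GL(n,F) = B(F)·GL(n,𝒪)`).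
* [Casselman1980] W. Casselman, *The unramified principal series of p-adic groups I*, Compositio Math. 40 (1980): §3.
* [Langlands1971] R. P. Langlands, *Euler Products*, Yale (1971): §3 (the rank-one `GL₃` computation).
* [MoeglinWaldspurger1995] C. Mœglin, J.-L. Waldspurger, *Spectral Decomposition and Eisenstein Series* (1995): I.2.2, II.1.6.
* [Rogawski1990] J. D. Rogawski, *Automorphic Representations of Unitary Groups in Three Variables*, Ann. of Math. Stud. 123 (1990): §1.10 p. 9, §4.5 p. 45, §13.9 p. 229.
-/

set_option autoImplicit false
set_option linter.dupNamespace false -- the mandated namespace repeats `HodgeConjecture.HodgeConjecture`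

noncomputable section

open scoped NNReal Matrix
open Literature.NumberTheory.Automorphic
open Literature.NumberTheory.GaloisRepresentations Literature.NumberTheory.GaloisRepresentations.IsNonarchimedeanLocalField

namespace Summit.HodgeConjecture.HodgeConjecture.Cruxes.H413.K2E1BigCellIwasawaTorusEntrySplitU3

variable {F : Type*} [Field F] [ValuativeRel F] [TopologicalSpace F] [IsNonarchimedeanLocalField F]

/-! ## §1 Rows and columns of `GL_n(𝒪)` are primitive -/

section Primitive

variable {n : ℕ}

/-- Finite ultrametric sums: if every term has `‖f i‖ ≤ C` then `‖Σ f i‖ ≤ C`. [folklore] -/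
theorem normAbs_sum_le_of_forall_le {ι : Type*} (s : Finset ι) (f : ι → F) {C : ℝ≥0} (h : ∀ i ∈ s, normAbs F (f i) ≤ C) :
    normAbs F (∑ i ∈ s, f i) ≤ C := by
  classical
  induction s using Finset.induction_on with
  | empty => simp
  | insert a s ha ih =>
    rw [Finset.sum_insert ha]
    exact (normAbs_add_le_max _ _).trans (max_le (h a (Finset.mem_insert_self a s)) (ih fun i hi => h i (Finset.mem_insert_of_mem hi)))

/-- **Ultrametric pigeonhole**: if `Σ_l a_l c_l = 1` with all `‖c_l‖ ≤ 1`, some `a_l` has `‖a_l‖ ≥ 1` (else `‖1‖ ≤ max_l ‖a_l‖ < 1`). [folklore] -/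
theorem exists_one_le_normAbs_of_sum_mul_eq_one {ι : Type*} [Fintype ι] {a c : ι → F} (hc : ∀ l, normAbs F (c l) ≤ 1)
    (h : ∑ l, a l * c l = 1) : ∃ l, 1 ≤ normAbs F (a l) := by
  by_contra hlt
  push Not at hlt
  rcases (Finset.univ : Finset ι).eq_empty_or_nonempty with he | hne
  · rw [he, Finset.sum_empty] at h
    exact zero_ne_one h
  · obtain ⟨l₀, -, hl₀⟩ := Finset.exists_max_image Finset.univ (fun l => normAbs F (a l)) hne
    have hsum : normAbs F (∑ l, a l * c l) ≤ normAbs F (a l₀) :=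
      normAbs_sum_le_of_forall_le _ _ fun l hl => by
        rw [map_mul]
        exact (mul_le_mul' (hl₀ l hl) (hc l)).trans_eq (mul_one _)
    rw [h, map_one] at hsum
    exact absurd (hsum.trans_lt (hlt l₀)) (lt_irrefl 1)

/-- Entries of `k ∈ GL_n(𝒪)` lie in the closed unit ball. [folklore] -/
theorem normAbs_apply_le_one_of_mem_glInt {k : GL (Fin n) F} (hk : k ∈ glInt n F) (i j : Fin n) :
    normAbs F ((k : Matrix (Fin n) (Fin n) F) i j) ≤ 1 :=
  normAbs_le_one_iff.2 (isIntegralMatrix_of_mem_glInt hk i j)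

/-- Entries of `k⁻¹`, `k ∈ GL_n(𝒪)`, lie in the closed unit ball. [folklore] -/
theorem normAbs_inv_apply_le_one_of_mem_glInt {k : GL (Fin n) F} (hk : k ∈ glInt n F) (i j : Fin n) :
    normAbs F (((k⁻¹ : GL (Fin n) F) : Matrix (Fin n) (Fin n) F) i j) ≤ 1 :=
  normAbs_le_one_iff.2 (isIntegralMatrix_inv_of_mem_glInt hk i j)

/-- **ROWS OF `GL_n(𝒪)` ARE PRIMITIVE**: every row of `k ∈ GL_n(𝒪)` has an entry of absolute value `1` (from `Σ_j k_ij (k⁻¹)_ji = 1`). [cite: Bump1997, Prop. 4.5.2] -/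
theorem exists_normAbs_row_eq_one_of_mem_glInt {k : GL (Fin n) F} (hk : k ∈ glInt n F) (i : Fin n) :
    ∃ j, normAbs F ((k : Matrix (Fin n) (Fin n) F) i j) = 1 := by
  have h : ∑ j, (k : Matrix (Fin n) (Fin n) F) i j * ((k⁻¹ : GL (Fin n) F) : Matrix (Fin n) (Fin n) F) j i = 1 := by
    rw [← Matrix.mul_apply, ← Units.val_mul, mul_inv_cancel, Units.val_one, Matrix.one_apply_eq]
  obtain ⟨j, hj⟩ := exists_one_le_normAbs_of_sum_mul_eq_one (fun j => normAbs_inv_apply_le_one_of_mem_glInt hk j i) h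
  exact ⟨j, le_antisymm (normAbs_apply_le_one_of_mem_glInt hk i j) hj⟩

/-- **COLUMNS OF `GL_n(𝒪)` ARE PRIMITIVE**: every column of `k ∈ GL_n(𝒪)` has an entry of absolute value `1` (from `Σ_i (k⁻¹)_ji k_ij = 1`). [cite: Bump1997, Prop. 4.5.2] -/
theorem exists_normAbs_col_eq_one_of_mem_glInt {k : GL (Fin n) F} (hk : k ∈ glInt n F) (j : Fin n) :
    ∃ i, normAbs F ((k : Matrix (Fin n) (Fin n) F) i j) = 1 := by
  have h : ∑ i, (k : Matrix (Fin n) (Fin n) F) i j * ((k⁻¹ : GL (Fin n) F) : Matrix (Fin n) (Fin n) F) j i = 1 := by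
    simp_rw [mul_comm ((k : Matrix (Fin n) (Fin n) F) _ j)]
    rw [← Matrix.mul_apply, ← Units.val_mul, inv_mul_cancel, Units.val_one, Matrix.one_apply_eq]
  obtain ⟨i, hi⟩ := exists_one_le_normAbs_of_sum_mul_eq_one (fun i => normAbs_inv_apply_le_one_of_mem_glInt hk j i) h
  exact ⟨i, le_antisymm (normAbs_apply_le_one_of_mem_glInt hk i j) hi⟩

end Primitive

/-! ## §2 `GL₃`: the torus entries `b₂₂`, `b₀₀` of ANY factorisation `g = b·k` read on the bottom row of `g` and the first column of `g⁻¹`; the big cell `g = w₀ · n(x,y,z)` -/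

section Three

/-- Case analysis of an existential over `Fin 3`. [folklore] -/
theorem exists_fin_three {P : Fin 3 → Prop} (h : ∃ j, P j) : P 0 ∨ P 1 ∨ P 2 := by
  obtain ⟨j, hj⟩ := h
  fin_cases j
  exacts [Or.inl hj, Or.inr (Or.inl hj), Or.inr (Or.inr hj)]

omit [ValuativeRel F] [TopologicalSpace F] [IsNonarchimedeanLocalField F] in
/-- For `b` upper triangular the bottom row of `b·k` is `b₂₂ · (bottom row of k)`. [folklore] -/
theorem borel_mul_apply_two {b k : GL (Fin 3) F} (hb : (b : Matrix (Fin 3) (Fin 3) F).BlockTriangular id) (j : Fin 3) :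
    ((b * k : GL (Fin 3) F) : Matrix (Fin 3) (Fin 3) F) 2 j = (b : Matrix (Fin 3) (Fin 3) F) 2 2 * (k : Matrix (Fin 3) (Fin 3) F) 2 j := by
  have h20 : (b : Matrix (Fin 3) (Fin 3) F) 2 0 = 0 := hb (by decide)
  have h21 : (b : Matrix (Fin 3) (Fin 3) F) 2 1 = 0 := hb (by decide)
  rw [Units.val_mul, Matrix.mul_apply, Fin.sum_univ_three, h20, h21, zero_mul, zero_mul, zero_add, zero_add]

/-- For `g = b·k`, `b` upper triangular, `k ∈ GL₃(𝒪)`: every bottom-row entry of `g` has `‖g₂ⱼ‖ ≤ ‖b₂₂‖`. [cite: Bump1997, Prop. 4.5.2] -/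
theorem normAbs_apply_two_le_of_eq_borel_mul {g b k : GL (Fin 3) F} (hb : (b : Matrix (Fin 3) (Fin 3) F).BlockTriangular id) (hk : k ∈ glInt 3 F)
    (h : g = b * k) (j : Fin 3) :
    normAbs F ((g : Matrix (Fin 3) (Fin 3) F) 2 j) ≤ normAbs F ((b : Matrix (Fin 3) (Fin 3) F) 2 2) := by
  rw [h, borel_mul_apply_two hb, map_mul]
  exact (mul_le_mul' le_rfl (normAbs_apply_le_one_of_mem_glInt hk 2 j)).trans_eq (mul_one _)

/-- For `g = b·k`, `b` upper triangular, `k ∈ GL₃(𝒪)`: SOME bottom-row entry of `g` has `‖g₂ⱼ‖ = ‖b₂₂‖` (primitivity of the bottom row of `k`). [cite: Bump1997, Prop. 4.5.2] -/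
theorem exists_normAbs_apply_two_eq_of_eq_borel_mul {g b k : GL (Fin 3) F} (hb : (b : Matrix (Fin 3) (Fin 3) F).BlockTriangular id) (hk : k ∈ glInt 3 F)
    (h : g = b * k) :
    ∃ j : Fin 3, normAbs F ((g : Matrix (Fin 3) (Fin 3) F) 2 j) = normAbs F ((b : Matrix (Fin 3) (Fin 3) F) 2 2) := by
  obtain ⟨j, hj⟩ := exists_normAbs_row_eq_one_of_mem_glInt hk 2
  exact ⟨j, by rw [h, borel_mul_apply_two hb, map_mul, hj, mul_one]⟩

omit [ValuativeRel F] [TopologicalSpace F] [IsNonarchimedeanLocalField F] in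
/-- For `g = b·k`, `b` upper triangular: the first column of `k⁻¹ = g⁻¹·b` is `b₀₀ · (first column of g⁻¹)`. [folklore] -/
theorem inv_apply_zero_of_eq_borel_mul {g b k : GL (Fin 3) F} (hb : (b : Matrix (Fin 3) (Fin 3) F).BlockTriangular id) (h : g = b * k) (i : Fin 3) :
    ((k⁻¹ : GL (Fin 3) F) : Matrix (Fin 3) (Fin 3) F) i 0 = ((g⁻¹ : GL (Fin 3) F) : Matrix (Fin 3) (Fin 3) F) i 0 * (b : Matrix (Fin 3) (Fin 3) F) 0 0 := by
  have hk : (k⁻¹ : GL (Fin 3) F) = g⁻¹ * b := by rw [h, mul_inv_rev, inv_mul_cancel_right]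
  have h10 : (b : Matrix (Fin 3) (Fin 3) F) 1 0 = 0 := hb (by decide)
  have h20 : (b : Matrix (Fin 3) (Fin 3) F) 2 0 = 0 := hb (by decide)
  rw [hk, Units.val_mul, Matrix.mul_apply, Fin.sum_univ_three, h10, h20, mul_zero, mul_zero, add_zero, add_zero]

/-- For `g = b·k`, `b` upper triangular, `k ∈ GL₃(𝒪)`: every first-column entry of `g⁻¹` has `‖(g⁻¹)ᵢ₀‖ · ‖b₀₀‖ ≤ 1`. [cite: Bump1997, Prop. 4.5.2] -/
theorem normAbs_inv_apply_zero_mul_le_of_eq_borel_mul {g b k : GL (Fin 3) F} (hb : (b : Matrix (Fin 3) (Fin 3) F).BlockTriangular id) (hk : k ∈ glInt 3 F)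
    (h : g = b * k) (i : Fin 3) :
    normAbs F (((g⁻¹ : GL (Fin 3) F) : Matrix (Fin 3) (Fin 3) F) i 0) * normAbs F ((b : Matrix (Fin 3) (Fin 3) F) 0 0) ≤ 1 := by
  rw [← map_mul, ← inv_apply_zero_of_eq_borel_mul hb h i]
  exact normAbs_inv_apply_le_one_of_mem_glInt hk i 0

/-- For `g = b·k`, `b` upper triangular, `k ∈ GL₃(𝒪)`: SOME first-column entry of `g⁻¹` has `‖(g⁻¹)ᵢ₀‖ · ‖b₀₀‖ = 1` (primitivity of the first column of `k⁻¹ ∈ GL₃(𝒪)`).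
[cite: Bump1997, Prop. 4.5.2] -/
theorem exists_normAbs_inv_apply_zero_mul_eq_of_eq_borel_mul {g b k : GL (Fin 3) F} (hb : (b : Matrix (Fin 3) (Fin 3) F).BlockTriangular id) (hk : k ∈ glInt 3 F)
    (h : g = b * k) :
    ∃ i : Fin 3, normAbs F (((g⁻¹ : GL (Fin 3) F) : Matrix (Fin 3) (Fin 3) F) i 0) * normAbs F ((b : Matrix (Fin 3) (Fin 3) F) 0 0) = 1 := by
  obtain ⟨i, hi⟩ := exists_normAbs_col_eq_one_of_mem_glInt (Subgroup.inv_mem _ hk) 0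
  exact ⟨i, by rw [← map_mul, ← inv_apply_zero_of_eq_borel_mul hb h i, hi]⟩

/-! ### The big cell `w₀ · n(x, y, z)`: explicit matrices -/

omit [ValuativeRel F] [TopologicalSpace F] [IsNonarchimedeanLocalField F] in
/-- `w₀ · n(x,y,z) = (0 0 1; 0 1 y; 1 x z)`: the bottom row of the big-cell element is `(1, x, z)`. [cite: Langlands1971, §3] -/
theorem weylLong_mul_heis_val {x y z : F} {w₀ n : GL (Fin 3) F} (hw₀ : (w₀ : Matrix (Fin 3) (Fin 3) F) = !![(0 : F), 0, 1; 0, 1, 0; 1, 0, 0])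
    (hn : (n : Matrix (Fin 3) (Fin 3) F) = !![1, x, z; 0, 1, y; 0, 0, 1]) :
    ((w₀ * n : GL (Fin 3) F) : Matrix (Fin 3) (Fin 3) F) = !![(0 : F), 0, 1; 0, 1, y; 1, x, z] := by
  rw [Units.val_mul, hw₀, hn]
  ext i j
  fin_cases i <;> fin_cases j <;> simp [Matrix.mul_apply, Fin.sum_univ_three, Matrix.cons_val_zero, Matrix.cons_val_one]

omit [ValuativeRel F] [TopologicalSpace F] [IsNonarchimedeanLocalField F] in
/-- `n(x,y,z)⁻¹ = (1 −x xy−z; 0 1 −y; 0 0 1)`. [cite: Rogawski1990, §1.10 p. 9] -/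
theorem heis_inv_val {x y z : F} {n : GL (Fin 3) F} (hn : (n : Matrix (Fin 3) (Fin 3) F) = !![1, x, z; 0, 1, y; 0, 0, 1]) :
    ((n⁻¹ : GL (Fin 3) F) : Matrix (Fin 3) (Fin 3) F) = !![1, -x, x * y - z; 0, 1, -y; 0, 0, 1] := by
  refine Units.inv_eq_of_mul_eq_one_right ?_
  rw [hn]
  ext i j
  fin_cases i <;> fin_cases j <;> simp [Matrix.mul_apply, Fin.sum_univ_three, Matrix.cons_val_zero, Matrix.cons_val_one]
  ring

omit [ValuativeRel F] [TopologicalSpace F] [IsNonarchimedeanLocalField F] in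
/-- `w₀⁻¹ = w₀` (`w₀² = 1`). [cite: Rogawski1990, §1.10 p. 9] -/
theorem weylLong_inv_val {w₀ : GL (Fin 3) F} (hw₀ : (w₀ : Matrix (Fin 3) (Fin 3) F) = !![(0 : F), 0, 1; 0, 1, 0; 1, 0, 0]) :
    ((w₀⁻¹ : GL (Fin 3) F) : Matrix (Fin 3) (Fin 3) F) = !![(0 : F), 0, 1; 0, 1, 0; 1, 0, 0] := by
  refine Units.inv_eq_of_mul_eq_one_right ?_
  rw [hw₀]
  ext i j
  fin_cases i <;> fin_cases j <;> simp [Matrix.mul_apply, Fin.sum_univ_three, Matrix.cons_val_zero, Matrix.cons_val_one]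

omit [ValuativeRel F] [TopologicalSpace F] [IsNonarchimedeanLocalField F] in
/-- `(w₀ · n(x,y,z))⁻¹ = n⁻¹ · w₀ = (xy−z  −x  1; −y  1  0; 1  0  0)`: the first column of the inverse big-cell element is `(xy − z, −y, 1)ᵀ` — the cofactors
`|t₂t₃|`-row of Langlands' `GL₃` computation. [cite: Langlands1971, §3] -/
theorem weylLong_mul_heis_inv_val {x y z : F} {w₀ n : GL (Fin 3) F} (hw₀ : (w₀ : Matrix (Fin 3) (Fin 3) F) = !![(0 : F), 0, 1; 0, 1, 0; 1, 0, 0])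
    (hn : (n : Matrix (Fin 3) (Fin 3) F) = !![1, x, z; 0, 1, y; 0, 0, 1]) :
    (((w₀ * n)⁻¹ : GL (Fin 3) F) : Matrix (Fin 3) (Fin 3) F) = !![x * y - z, -x, 1; -y, 1, 0; 1, 0, 0] := by
  rw [mul_inv_rev, Units.val_mul, heis_inv_val hn, weylLong_inv_val hw₀]
  ext i j
  fin_cases i <;> fin_cases j <;> simp [Matrix.mul_apply, Fin.sum_univ_three, Matrix.cons_val_zero, Matrix.cons_val_one]

/-! ### The torus entries of the big cell are the two Gindikin–Karpelevich heights -/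

/-- **`‖b₂₂‖ = max(1, |x|, |z|) = A`** for EVERY factorisation `w₀ · n(x,y,z) = b · k`, `b` upper triangular, `k ∈ GL₃(𝒪)`: the last Iwasawa torus entry of the big cell has absolute
value the first Gindikin–Karpelevich height («`|t₃| = A`» of ★ `K2E1GindikinKarpelevichSplitGL3`; the bottom row `(1,x,z)` of `w₀ n` is `b₂₂` times the primitive bottom row of `k`).
[cite: Bump1997, Prop. 4.5.2] [cite: Langlands1971, §3] [cite: Casselman1980, §3] -/
theorem normAbs_borel_two_two_eq_heightA {x y z : F} {w₀ n b k : GL (Fin 3) F} (hw₀ : (w₀ : Matrix (Fin 3) (Fin 3) F) = !![(0 : F), 0, 1; 0, 1, 0; 1, 0, 0])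
    (hn : (n : Matrix (Fin 3) (Fin 3) F) = !![1, x, z; 0, 1, y; 0, 0, 1]) (hb : (b : Matrix (Fin 3) (Fin 3) F).BlockTriangular id) (hk : k ∈ glInt 3 F)
    (h : w₀ * n = b * k) :
    ((normAbs F ((b : Matrix (Fin 3) (Fin 3) F) 2 2) : ℝ≥0) : ℝ) = max 1 (max ((normAbs F x : ℝ≥0) : ℝ) ((normAbs F z : ℝ≥0) : ℝ)) := by
  have hrow := weylLong_mul_heis_val hw₀ hn
  have g20 : ((w₀ * n : GL (Fin 3) F) : Matrix (Fin 3) (Fin 3) F) 2 0 = 1 := by rw [hrow]; rfl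
  have g21 : ((w₀ * n : GL (Fin 3) F) : Matrix (Fin 3) (Fin 3) F) 2 1 = x := by rw [hrow]; rfl
  have g22 : ((w₀ * n : GL (Fin 3) F) : Matrix (Fin 3) (Fin 3) F) 2 2 = z := by rw [hrow]; rfl
  have hle := normAbs_apply_two_le_of_eq_borel_mul hb hk h
  have h0 := hle 0; have h1 := hle 1; have h2 := hle 2
  rw [g20, map_one] at h0; rw [g21] at h1; rw [g22] at h2
  rw [← NNReal.coe_one, ← NNReal.coe_max, ← NNReal.coe_max, NNReal.coe_inj]
  refine le_antisymm ?_ (max_le h0 (max_le h1 h2))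
  rcases exists_fin_three (exists_normAbs_apply_two_eq_of_eq_borel_mul hb hk h) with hj | hj | hj
  · rw [g20, map_one] at hj; rw [← hj]; exact le_max_left _ _
  · rw [g21] at hj; rw [← hj]; exact le_max_of_le_right (le_max_left _ _)
  · rw [g22] at hj; rw [← hj]; exact le_max_of_le_right (le_max_right _ _)

/-- **`‖b₀₀‖ · max(1, |y|, |z − xy|) = ‖b₀₀‖ · B = 1`** for EVERY factorisation `w₀ · n(x,y,z) = b · k`, `b` upper triangular, `k ∈ GL₃(𝒪)`: the first Iwasawa torus entry of the big
cell has absolute value the inverse of the second Gindikin–Karpelevich height («`|t₂t₃| = B`, `|t₁t₂t₃| = 1`» of ★ `K2E1GindikinKarpelevichSplitGL3`; the first column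
`(xy − z, −y, 1)ᵀ` of `(w₀ n)⁻¹` is `b₀₀⁻¹` times the primitive first column of `k⁻¹`). [cite: Bump1997, Prop. 4.5.2] [cite: Langlands1971, §3] [cite: Casselman1980, §3] -/
theorem normAbs_borel_zero_zero_mul_heightB_eq_one {x y z : F} {w₀ n b k : GL (Fin 3) F} (hw₀ : (w₀ : Matrix (Fin 3) (Fin 3) F) = !![(0 : F), 0, 1; 0, 1, 0; 1, 0, 0])
    (hn : (n : Matrix (Fin 3) (Fin 3) F) = !![1, x, z; 0, 1, y; 0, 0, 1]) (hb : (b : Matrix (Fin 3) (Fin 3) F).BlockTriangular id) (hk : k ∈ glInt 3 F)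
    (h : w₀ * n = b * k) :
    ((normAbs F ((b : Matrix (Fin 3) (Fin 3) F) 0 0) : ℝ≥0) : ℝ) * max 1 (max ((normAbs F y : ℝ≥0) : ℝ) ((normAbs F (z - x * y) : ℝ≥0) : ℝ)) = 1 := by
  have hcol := weylLong_mul_heis_inv_val hw₀ hn
  have c00 : (((w₀ * n)⁻¹ : GL (Fin 3) F) : Matrix (Fin 3) (Fin 3) F) 0 0 = x * y - z := by rw [hcol]; rfl
  have c10 : (((w₀ * n)⁻¹ : GL (Fin 3) F) : Matrix (Fin 3) (Fin 3) F) 1 0 = -y := by rw [hcol]; rfl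
  have c20 : (((w₀ * n)⁻¹ : GL (Fin 3) F) : Matrix (Fin 3) (Fin 3) F) 2 0 = 1 := by rw [hcol]; rfl
  have hle := normAbs_inv_apply_zero_mul_le_of_eq_borel_mul hb hk h
  have h0 := hle 0; have h1 := hle 1; have h2 := hle 2
  rw [c00, ← neg_sub, normAbs_neg] at h0
  rw [c10, normAbs_neg] at h1
  rw [c20, map_one, one_mul] at h2
  rw [← NNReal.coe_one, ← NNReal.coe_max, ← NNReal.coe_max, ← NNReal.coe_mul, NNReal.coe_inj, mul_comm, ← max_mul_mul_right, ← max_mul_mul_right, one_mul]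
  refine le_antisymm (max_le h2 (max_le h1 h0)) ?_
  rcases exists_fin_three (exists_normAbs_inv_apply_zero_mul_eq_of_eq_borel_mul hb hk h) with hi | hi | hi
  · rw [c00, ← neg_sub, normAbs_neg] at hi; rw [← hi]; exact le_max_of_le_right (le_max_right _ _)
  · rw [c10, normAbs_neg] at hi; rw [← hi]; exact le_max_of_le_right (le_max_left _ _)
  · rw [c20, map_one, one_mul] at hi; rw [← hi]; exact le_max_left _ _

/-- **`‖b₀₀ · b₁₁ · b₂₂‖ = 1`** for every factorisation `w₀ · n = b · k`, `b` upper triangular, `k ∈ GL₃(𝒪)` (`det(w₀ n) = −1`, `‖det k‖ = 1`; «`|t₁t₂t₃| = 1`»).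
[cite: Bump1997, Prop. 4.5.2] [cite: Langlands1971, §3] -/
theorem normAbs_borel_diag_prod_eq_one {x y z : F} {w₀ n b k : GL (Fin 3) F} (hw₀ : (w₀ : Matrix (Fin 3) (Fin 3) F) = !![(0 : F), 0, 1; 0, 1, 0; 1, 0, 0])
    (hn : (n : Matrix (Fin 3) (Fin 3) F) = !![1, x, z; 0, 1, y; 0, 0, 1]) (hb : (b : Matrix (Fin 3) (Fin 3) F).BlockTriangular id) (hk : k ∈ glInt 3 F)
    (h : w₀ * n = b * k) :
    normAbs F ((b : Matrix (Fin 3) (Fin 3) F) 0 0 * (b : Matrix (Fin 3) (Fin 3) F) 1 1 * (b : Matrix (Fin 3) (Fin 3) F) 2 2) = 1 := by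
  -- `det b = b₀₀ b₁₁ b₂₂`, `det (w₀ n) = -1`, `det b · det k = det (w₀ n)`
  have hdetb : (b : Matrix (Fin 3) (Fin 3) F).det = (b : Matrix (Fin 3) (Fin 3) F) 0 0 * (b : Matrix (Fin 3) (Fin 3) F) 1 1 * (b : Matrix (Fin 3) (Fin 3) F) 2 2 := by
    rw [Matrix.det_of_upperTriangular hb, Fin.prod_univ_three]
  have hdetg : ((w₀ * n : GL (Fin 3) F) : Matrix (Fin 3) (Fin 3) F).det = -1 := by
    rw [weylLong_mul_heis_val hw₀ hn, Matrix.det_fin_three]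
    simp [Matrix.cons_val_zero, Matrix.cons_val_one]
  have hdetk : normAbs F (k : Matrix (Fin 3) (Fin 3) F).det = 1 :=
    le_antisymm (normAbs_le_one_iff.2 (isIntegralMatrix_of_mem_glInt hk).det_mem) (by
      have h1 : (k : Matrix (Fin 3) (Fin 3) F).det * ((k⁻¹ : GL (Fin 3) F) : Matrix (Fin 3) (Fin 3) F).det = 1 := by
        rw [← Matrix.det_mul, ← Units.val_mul, mul_inv_cancel, Units.val_one, Matrix.det_one]
      have h2 : normAbs F (k : Matrix (Fin 3) (Fin 3) F).det * normAbs F ((k⁻¹ : GL (Fin 3) F) : Matrix (Fin 3) (Fin 3) F).det = 1 := by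
        rw [← map_mul, h1, map_one]
      by_contra hlt
      push Not at hlt
      have := mul_lt_one_of_lt_of_le hlt (normAbs_le_one_iff.2 (isIntegralMatrix_inv_of_mem_glInt hk).det_mem)
      rw [h2] at this
      exact lt_irrefl _ this)
  have hprod : (b : Matrix (Fin 3) (Fin 3) F).det * (k : Matrix (Fin 3) (Fin 3) F).det = -1 := by
    rw [← Matrix.det_mul, ← Units.val_mul, ← h, hdetg]
  have := congrArg (normAbs F) hprod
  rw [map_mul, hdetk, mul_one, normAbs_neg, map_one] at this
  rw [← hdetb, this]

end Three

/-! ## §3 The split-place torus-entry witness in the base coordinates `Φ(p) = (p₀ + δ₁p₁, −(p₀ − δ₁p₁), δ₁p₂ − ½(p₀+δ₁p₁)(p₀−δ₁p₁))` -/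

section Witness

/-- **THE SPLIT-PLACE IWASAWA TORUS-ENTRY WITNESS** (base coordinates of ★ `K2E1IntertwiningLocalMeanSplitU3` ∕ ★ (W) §3, ANY `δ₁ : F`; the letters (α) of ★
`K2E1ChiLocalWeightShellU3.shell_split_of_torusEntries` and of ★ `K2E1ChiLocalMeansOfShellU3Letters.hsp_of_torusEntries`, byte for byte, plus the factorisation that carries the
weight letters (c)).  Let `w₀ ∈ GL₃(F)` have matrix `antidiag(1,1,1)` and let `n(p) ∈ GL₃(F)` have matrix `(1 x z; 0 1 y; 0 0 1)` at `(x, y, z) = Φ(p)` for every `p : Fin 3 → F` (any terms: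
the consumer's `localSplitEquiv`-images of `ι(w₀)` and of the Heisenberg element `u(X, Z)` at the base point `p`).  THEN there are functions `b k : (Fin 3 → F) → GL₃(F)` and
`α₁ α₂ : (Fin 3 → F) → F^×` with, for every `p`: `w₀ · n(p) = b(p) · k(p)` (Iwasawa, ★ Bump 4.5.2), `b(p)` upper triangular, `k(p) ∈ GL₃(𝒪)`, `b(p)₂₂ = (α₁ p)⁻¹`, `b(p)₀₀ = α₂ p`,
and the TORUS-ENTRY LETTERS `‖α₁ p‖ · A(p) = 1`, `‖α₂ p‖ · B(p) = 1` — unguarded, and in the guarded shape `1 < A(p) → …`, `1 < B(p) → …` of the letters — where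
`A(p) = max(1, ‖p₀ + δ₁p₁‖, ‖δ₁p₂ − ½(p₀+δ₁p₁)(p₀−δ₁p₁)‖)`, `B(p) = max(1, ‖−(p₀ − δ₁p₁)‖, ‖δ₁p₂ − ½(p₀+δ₁p₁)(p₀−δ₁p₁) − (p₀+δ₁p₁)(−(p₀−δ₁p₁))‖)`.
(Which character an unramified Borel datum puts on `α₁`, `α₂` is the consumer's reading: for `J = Φ₃` the `U(2,1)` first torus entry is `(b₀₀, τ(b₂₂)⁻¹) ∈ L_w^× × L_w̄^×`, see the module
docstring.) [cite: Bump1997, Prop. 4.5.2] [cite: Langlands1971, §3] [cite: Casselman1980, §3] [cite: Rogawski1990, §4.5 p. 45] -/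
theorem exists_iwasawa_torusEntries_split (δ₁ : F) {w₀ : GL (Fin 3) F} (hw₀ : (w₀ : Matrix (Fin 3) (Fin 3) F) = !![(0 : F), 0, 1; 0, 1, 0; 1, 0, 0])
    (n : (Fin 3 → F) → GL (Fin 3) F)
    (hn : ∀ p : Fin 3 → F, (n p : Matrix (Fin 3) (Fin 3) F) =
      !![1, p 0 + δ₁ * p 1, δ₁ * p 2 - 2⁻¹ * (p 0 + δ₁ * p 1) * (p 0 - δ₁ * p 1); 0, 1, -(p 0 - δ₁ * p 1); 0, 0, 1]) :
    ∃ (b k : (Fin 3 → F) → GL (Fin 3) F) (α₁ α₂ : (Fin 3 → F) → Fˣ),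
      (∀ p : Fin 3 → F, w₀ * n p = b p * k p) ∧
      (∀ p : Fin 3 → F, b p ∈ standardParabolicGL F (id : Fin 3 → Fin 3)) ∧
      (∀ p : Fin 3 → F, k p ∈ glInt 3 F) ∧
      (∀ p : Fin 3 → F, (b p : Matrix (Fin 3) (Fin 3) F) 2 2 = ((α₁ p)⁻¹ : Fˣ)) ∧
      (∀ p : Fin 3 → F, (b p : Matrix (Fin 3) (Fin 3) F) 0 0 = α₂ p) ∧
      (∀ p : Fin 3 → F, ((normAbs F (α₁ p : F) : ℝ≥0) : ℝ) * max 1 (max ((normAbs F (p 0 + δ₁ * p 1) : ℝ≥0) : ℝ)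
          ((normAbs F (δ₁ * p 2 - 2⁻¹ * (p 0 + δ₁ * p 1) * (p 0 - δ₁ * p 1)) : ℝ≥0) : ℝ)) = 1) ∧
      (∀ p : Fin 3 → F, ((normAbs F (α₂ p : F) : ℝ≥0) : ℝ) * max 1 (max ((normAbs F (-(p 0 - δ₁ * p 1)) : ℝ≥0) : ℝ)
          ((normAbs F (δ₁ * p 2 - 2⁻¹ * (p 0 + δ₁ * p 1) * (p 0 - δ₁ * p 1) - (p 0 + δ₁ * p 1) * (-(p 0 - δ₁ * p 1))) : ℝ≥0) : ℝ)) = 1) ∧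
      (∀ p : Fin 3 → F, 1 < max 1 (max ((normAbs F (p 0 + δ₁ * p 1) : ℝ≥0) : ℝ) ((normAbs F (δ₁ * p 2 - 2⁻¹ * (p 0 + δ₁ * p 1) * (p 0 - δ₁ * p 1)) : ℝ≥0) : ℝ)) →
        ((normAbs F (α₁ p : F) : ℝ≥0) : ℝ) * max 1 (max ((normAbs F (p 0 + δ₁ * p 1) : ℝ≥0) : ℝ) ((normAbs F (δ₁ * p 2 - 2⁻¹ * (p 0 + δ₁ * p 1) * (p 0 - δ₁ * p 1)) : ℝ≥0) : ℝ)) = 1) ∧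
      (∀ p : Fin 3 → F, 1 < max 1 (max ((normAbs F (-(p 0 - δ₁ * p 1)) : ℝ≥0) : ℝ)
          ((normAbs F (δ₁ * p 2 - 2⁻¹ * (p 0 + δ₁ * p 1) * (p 0 - δ₁ * p 1) - (p 0 + δ₁ * p 1) * (-(p 0 - δ₁ * p 1))) : ℝ≥0) : ℝ)) →
        ((normAbs F (α₂ p : F) : ℝ≥0) : ℝ) * max 1 (max ((normAbs F (-(p 0 - δ₁ * p 1)) : ℝ≥0) : ℝ)
          ((normAbs F (δ₁ * p 2 - 2⁻¹ * (p 0 + δ₁ * p 1) * (p 0 - δ₁ * p 1) - (p 0 + δ₁ * p 1) * (-(p 0 - δ₁ * p 1))) : ℝ≥0) : ℝ)) = 1) := by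
  -- Iwasawa for each `p` (★ Bump 4.5.2), then the two height identities of §2
  have hI : ∀ p : Fin 3 → F, ∃ b ∈ standardParabolicGL F (id : Fin 3 → Fin 3), ∃ k ∈ glInt 3 F, w₀ * n p = b * k := fun p => exists_borel_mul_glInt (w₀ * n p)
  choose b hb k hk hbk using hI
  have hb' : ∀ p, (b p : Matrix (Fin 3) (Fin 3) F).BlockTriangular id := fun p => (mem_standardParabolicGL_iff _ _).1 (hb p)
  have h22 : ∀ p, (b p : Matrix (Fin 3) (Fin 3) F) 2 2 ≠ 0 := fun p => apply_self_ne_zero_of_blockTriangular (b p) (hb' p) 2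
  have h00 : ∀ p, (b p : Matrix (Fin 3) (Fin 3) F) 0 0 ≠ 0 := fun p => apply_self_ne_zero_of_blockTriangular (b p) (hb' p) 0
  have hA : ∀ p : Fin 3 → F, ((normAbs F (((Units.mk0 _ (h22 p))⁻¹ : Fˣ) : F) : ℝ≥0) : ℝ) * max 1 (max ((normAbs F (p 0 + δ₁ * p 1) : ℝ≥0) : ℝ)
      ((normAbs F (δ₁ * p 2 - 2⁻¹ * (p 0 + δ₁ * p 1) * (p 0 - δ₁ * p 1)) : ℝ≥0) : ℝ)) = 1 := fun p => by
    rw [← normAbs_borel_two_two_eq_heightA hw₀ (hn p) (hb' p) (hk p) (hbk p), Units.val_inv_eq_inv_val, Units.val_mk0, map_inv₀, NNReal.coe_inv,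
      inv_mul_cancel₀]
    exact_mod_cast (map_ne_zero (normAbs F)).2 (h22 p)
  have hB : ∀ p : Fin 3 → F, ((normAbs F ((Units.mk0 _ (h00 p) : Fˣ) : F) : ℝ≥0) : ℝ) * max 1 (max ((normAbs F (-(p 0 - δ₁ * p 1)) : ℝ≥0) : ℝ)
      ((normAbs F (δ₁ * p 2 - 2⁻¹ * (p 0 + δ₁ * p 1) * (p 0 - δ₁ * p 1) - (p 0 + δ₁ * p 1) * (-(p 0 - δ₁ * p 1))) : ℝ≥0) : ℝ)) = 1 := fun p => by
    rw [Units.val_mk0]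
    exact normAbs_borel_zero_zero_mul_heightB_eq_one hw₀ (hn p) (hb' p) (hk p) (hbk p)
  refine ⟨b, k, fun p => (Units.mk0 _ (h22 p))⁻¹, fun p => Units.mk0 _ (h00 p), hbk, hb, hk, fun p => by rw [inv_inv, Units.val_mk0], fun p => by rw [Units.val_mk0],
    hA, hB, fun p _ => hA p, fun p _ => hB p⟩

end Witness

end Summit.HodgeConjecture.HodgeConjecture.Cruxes.H413.K2E1BigCellIwasawaTorusEntrySplitU3

end
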